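import Summits.ResolutionOfSingularities.ResolutionOfSingularities.Theorems.FrobeniusClosingClosingReductionPairIsoKit
import Summits.ResolutionOfSingularities.ResolutionOfSingularities.Theorems.FrobeniusClosingClosingReductionUnwinding

/-!
# Unwinding a periodic isolated chain to an eternal one, given successor transport
# (crux `NoPeriodicIsolatedAtom`, stmt-ResolutionOfSingularities-16344, line `ridge_rank`, stub `stub_unwind`)

Over a field `κ` algebraic over `𝔽_p` let `c₀ → c₁ → ⋯ → c_r` (`r > 0`) be an honest run of the
point-blow-up dynamics of `zᵖ = a(u₁, …, uₙ)` all of whose states are isolated of multiplicity `p`, and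
suppose the run RETURNS: `PairIso (run 0) (run r)`. Given the TRANSPORT OF SUCCESSOR POINTS along pair
isomorphisms (`Transport`, the named sub-statement of crux `ClosingReduction`'s line
`chart-factorization`, `Theorems/FrobeniusClosingDefs.lean`) we extend the run to an ETERNAL one with all
states isolated of multiplicity `p` (`unwind_of_transport`): stage by stage, the move made `r` steps
earlier is transported along `PairIso (run (s)) (run (r + s))` to a move at time `r + s`
(`Classical.choose`), the words are overwritten at that place only (so earlier states are unchanged,
`UnwindingProof.run_congr`), and `Isol`, `MultP` of the new state and the next pair isomorphism
`PairIso (run (s+1)) (run (r+s+1))` come from the LANDED pair-isomorphism kit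
(`stub_pairIsoKit`: invariance, transitivity). The eternal words are the diagonal of this stabilising
sequence of finite extensions. `κ` is of characteristic `p` and perfect (algebraic over `ZMod p`).
-/

noncomputable section

-- single-problem summit: the doubled namespace component is forced by the tree layout
set_option linter.dupNamespace false

open scoped Classical

namespace Summit.ResolutionOfSingularities.ResolutionOfSingularities.Theorems.FrobeniusClosing

namespace NoPeriodicUnwind

variable {p n : ℕ} {κ : Type} [Field κ]

/-- One stage of the extension: if the state at time `s` has multiplicity `p` and is pair-isomorphic to
the state at time `r + s`, transport the move `(w.1 s, w.2 s)` to time `r + s` (overwrite the words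
there); otherwise do nothing. [folklore] -/
theorem exists_extend (hT : Transport) (hp : p.Prime) (hn : 0 < n) [CharP κ p] [PerfectField κ]
    (c₀ : (Fin n → ℕ) → κ) (r s : ℕ) (w : (ℕ → Fin n) × (ℕ → Fin n → κ))
    (hM : MultP p n κ (run p n κ c₀ w.1 w.2 s))
    (hP : PairIso p n κ (run p n κ c₀ w.1 w.2 s) (run p n κ c₀ w.1 w.2 (r + s))) :
    ∃ w' : (ℕ → Fin n) × (ℕ → Fin n → κ),
      (∀ k, k < r + s → w'.1 k = w.1 k ∧ w'.2 k = w.2 k) ∧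
      PairIso p n κ (run p n κ c₀ w.1 w.2 (s + 1)) (run p n κ c₀ w'.1 w'.2 (r + s + 1)) ∧
      (∀ k, k ≤ r + s → run p n κ c₀ w'.1 w'.2 k = run p n κ c₀ w.1 w.2 k) := by
  obtain ⟨i', τ', hP'⟩ := hT p hp n hn κ _ _ hP hM (w.1 s) (w.2 s)
  refine ⟨(Function.update w.1 (r + s) i', Function.update w.2 (r + s) τ'), ?_, ?_, ?_⟩
  · intro k hk
    exact ⟨Function.update_of_ne (Nat.ne_of_lt hk) _ _, Function.update_of_ne (Nat.ne_of_lt hk) _ _⟩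
  · have hagree : ∀ k, k ≤ r + s →
        run p n κ c₀ (Function.update w.1 (r + s) i') (Function.update w.2 (r + s) τ') k =
          run p n κ c₀ w.1 w.2 k :=
      UnwindingProof.run_congr c₀ (fun k hk => Function.update_of_ne (Nat.ne_of_lt hk) _ _)
        (fun k hk => Function.update_of_ne (Nat.ne_of_lt hk) _ _)
    have hrun : run p n κ c₀ (Function.update w.1 (r + s) i') (Function.update w.2 (r + s) τ') (r + s + 1) =
        step p n κ i' τ' (run p n κ c₀ w.1 w.2 (r + s)) := by
      rw [UnwindingProof.run_succ, hagree (r + s) le_rfl, Function.update_self, Function.update_self]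
    rw [hrun, UnwindingProof.run_succ]
    exact hP'
  · exact UnwindingProof.run_congr c₀ (fun k hk => Function.update_of_ne (Nat.ne_of_lt hk) _ _)
      (fun k hk => Function.update_of_ne (Nat.ne_of_lt hk) _ _)

/-- The stabilising sequence of finite extensions: for every `s` there are words which extend the given
ones below `r`, whose run has its states `≤ r + s` isolated of multiplicity `p` with
`PairIso (run k) (run (r + k))` for `k ≤ s`, TOGETHER with a coherent choice one stage further.
We package the whole sequence as a function `W : ℕ → words` with the stage invariant and one-step
stability. [folklore] -/
theorem exists_sequence (hT : Transport) (hp : p.Prime) (hn : 0 < n) [CharP κ p] [PerfectField κ]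
    (c₀ : (Fin n → ℕ) → κ) (i : ℕ → Fin n) (t : ℕ → Fin n → κ) (r : ℕ) (hr : 0 < r)
    (hchain : ∀ m, m ≤ r → Isol p n κ (run p n κ c₀ i t m) ∧ MultP p n κ (run p n κ c₀ i t m))
    (hiso : PairIso p n κ (run p n κ c₀ i t 0) (run p n κ c₀ i t r)) :
    ∃ W : ℕ → (ℕ → Fin n) × (ℕ → Fin n → κ),
      (∀ s k, k < r + s → (W (s + 1)).1 k = (W s).1 k ∧ (W (s + 1)).2 k = (W s).2 k) ∧
      (∀ s k, k ≤ r + s →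
        Isol p n κ (run p n κ c₀ (W s).1 (W s).2 k) ∧ MultP p n κ (run p n κ c₀ (W s).1 (W s).2 k)) ∧
      (∀ s k, k ≤ s →
        PairIso p n κ (run p n κ c₀ (W s).1 (W s).2 k) (run p n κ c₀ (W s).1 (W s).2 (r + k))) := by
  obtain ⟨_, htrans, hinv⟩ := stub_pairIsoKit p hp n hn κ
  -- the stage map, defined by choice on `exists_extend` when its hypotheses hold
  let good : ℕ → (ℕ → Fin n) × (ℕ → Fin n → κ) → Prop := fun s w =>
    MultP p n κ (run p n κ c₀ w.1 w.2 s) ∧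
      PairIso p n κ (run p n κ c₀ w.1 w.2 s) (run p n κ c₀ w.1 w.2 (r + s))
  let next : ℕ → (ℕ → Fin n) × (ℕ → Fin n → κ) → (ℕ → Fin n) × (ℕ → Fin n → κ) := fun s w =>
    if h : good s w then Classical.choose (exists_extend hT hp hn c₀ r s w h.1 h.2) else w
  have next_spec : ∀ s w (h : good s w),
      (∀ k, k < r + s → (next s w).1 k = w.1 k ∧ (next s w).2 k = w.2 k) ∧
      PairIso p n κ (run p n κ c₀ w.1 w.2 (s + 1)) (run p n κ c₀ (next s w).1 (next s w).2 (r + s + 1)) ∧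
      (∀ k, k ≤ r + s → run p n κ c₀ (next s w).1 (next s w).2 k = run p n κ c₀ w.1 w.2 k) := by
    intro s w h
    have hdef : next s w = Classical.choose (exists_extend hT hp hn c₀ r s w h.1 h.2) := dif_pos h
    rw [hdef]
    exact Classical.choose_spec (exists_extend hT hp hn c₀ r s w h.1 h.2)
  -- the sequence
  let W : ℕ → (ℕ → Fin n) × (ℕ → Fin n → κ) := fun s => Nat.rec (i, t) (fun s w => next s w) s
  have W_zero : W 0 = (i, t) := rfl
  have W_succ : ∀ s, W (s + 1) = next s (W s) := fun s => rfl
  -- the stage invariant, by induction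
  have inv : ∀ s, (∀ k, k ≤ r + s →
        Isol p n κ (run p n κ c₀ (W s).1 (W s).2 k) ∧ MultP p n κ (run p n κ c₀ (W s).1 (W s).2 k)) ∧
      (∀ k, k ≤ s → PairIso p n κ (run p n κ c₀ (W s).1 (W s).2 k) (run p n κ c₀ (W s).1 (W s).2 (r + k))) := by
    intro s
    induction s with
    | zero =>
      refine ⟨fun k hk => hchain k hk, fun k hk => ?_⟩
      obtain rfl := Nat.le_zero.mp hk
      exact hiso
    | succ s ih =>
      obtain ⟨ihIM, ihP⟩ := ih
      have hgood : good s (W s) := ⟨(ihIM s (Nat.le_add_left s r)).2, ihP s le_rfl⟩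
      obtain ⟨_, hPnew, hagree⟩ := next_spec s (W s) hgood
      rw [W_succ]
      refine ⟨fun k hk => ?_, fun k hk => ?_⟩
      · rcases Nat.lt_or_ge k (r + s + 1) with hlt | hge
        · rw [hagree k (Nat.lt_succ_iff.mp hlt)]
          exact ihIM k (Nat.lt_succ_iff.mp hlt)
        · have hk' : k = r + s + 1 := le_antisymm hk hge
          subst hk'
          -- the new state is a transported successor
          obtain ⟨hI, hM, -⟩ := hinv _ _ hPnew
          have hs1 : s + 1 ≤ r + s := by omega
          exact ⟨hI.mp (ihIM (s + 1) hs1).1, hM.mp (ihIM (s + 1) hs1).2⟩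
      · rcases Nat.lt_or_ge k (s + 1) with hlt | hge
        · have hk1 : k ≤ r + s := by omega
          have hk2 : r + k ≤ r + s := by omega
          rw [hagree k hk1, hagree (r + k) hk2]
          exact ihP k (Nat.lt_succ_iff.mp hlt)
        · have hk' : k = s + 1 := le_antisymm hk hge
          subst hk'
          have hs1 : s + 1 ≤ r + s := by omega
          rw [hagree (s + 1) hs1, show r + (s + 1) = r + s + 1 from rfl]
          exact hPnew
  refine ⟨W, fun s k hk => ?_, fun s => (inv s).1, fun s => (inv s).2⟩
  have hgood : good s (W s) := ⟨((inv s).1 s (Nat.le_add_left s r)).2, (inv s).2 s le_rfl⟩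
  rw [W_succ]
  exact (next_spec s (W s) hgood).1 k hk

/-- **Unwinding, given transport**: a returning isolated multiplicity-`p` run over a field algebraic over
`𝔽_p` extends to an eternal isolated multiplicity-`p` run (the diagonal of `exists_sequence`).
[cite: HauserPerlega2019, §1 p. 3] -/
theorem unwind_eternal (hT : Transport) (hp : p.Prime) (hn : 0 < n) [CharP κ p] [PerfectField κ]
    (c₀ : (Fin n → ℕ) → κ) (i : ℕ → Fin n) (t : ℕ → Fin n → κ) (r : ℕ) (hr : 0 < r)
    (hchain : ∀ m, m ≤ r → Isol p n κ (run p n κ c₀ i t m) ∧ MultP p n κ (run p n κ c₀ i t m))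
    (hiso : PairIso p n κ (run p n κ c₀ i t 0) (run p n κ c₀ i t r)) :
    ∃ (i' : ℕ → Fin n) (t' : ℕ → Fin n → κ),
      ∀ m, Isol p n κ (run p n κ c₀ i' t' m) ∧ MultP p n κ (run p n κ c₀ i' t' m) := by
  obtain ⟨W, hstab, hIM, -⟩ := exists_sequence hT hp hn c₀ i t r hr hchain hiso
  -- stability across stages
  have hstab' : ∀ s d k, k < r + s → (W (s + d)).1 k = (W s).1 k ∧ (W (s + d)).2 k = (W s).2 k := by
    intro s d
    induction d with
    | zero => intro k _; exact ⟨rfl, rfl⟩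
    | succ d ih =>
      intro k hk
      have h1 := hstab (s + d) k (by omega)
      rw [show s + (d + 1) = s + d + 1 from rfl, h1.1, h1.2]
      exact ih k hk
  -- the diagonal words
  refine ⟨fun k => (W (k + 1)).1 k, fun k => (W (k + 1)).2 k, fun m => ?_⟩
  have hrun : ∀ k, k ≤ m →
      run p n κ c₀ (fun k => (W (k + 1)).1 k) (fun k => (W (k + 1)).2 k) k =
        run p n κ c₀ (W m).1 (W m).2 k := by
    refine UnwindingProof.run_congr c₀ (fun k hk => ?_) (fun k hk => ?_)
    · obtain ⟨d, hd⟩ := Nat.exists_eq_add_of_le (Nat.succ_le_of_lt hk)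
      rw [hd]
      exact ((hstab' (k + 1) d k (by omega)).1).symm
    · obtain ⟨d, hd⟩ := Nat.exists_eq_add_of_le (Nat.succ_le_of_lt hk)
      rw [hd]
      exact ((hstab' (k + 1) d k (by omega)).2).symm
  rw [hrun m le_rfl]
  exact hIM m m (Nat.le_add_left m r)

end NoPeriodicUnwind

/-- **Registered helper goal `unwind_of_transport`** — stub `stub_unwind` of line `ridge_rank` of crux
`NoPeriodicIsolatedAtom` MODULO the successor transport `Transport` of crux `ClosingReduction`'s line:
a returning isolated multiplicity-`p` chain over a field algebraic over `𝔽_p` makes the field perfect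
of characteristic `p` and extends to an eternal isolated multiplicity-`p` chain.
[cite: HauserPerlega2019, §1 p. 3] -/
theorem unwind_of_transport : Transport → ∀ p : ℕ, p.Prime → ∀ n : ℕ, 0 < n → ∀ (κ : Type) [Field κ]
    [Algebra (ZMod p) κ] [Algebra.IsAlgebraic (ZMod p) κ]
    (c₀ : (Fin n → ℕ) → κ) (i : ℕ → Fin n) (t : ℕ → Fin n → κ) (r : ℕ), 0 < r →
    (∀ m, m ≤ r → Isol p n κ (run p n κ c₀ i t m) ∧ MultP p n κ (run p n κ c₀ i t m)) →
    PairIso p n κ (run p n κ c₀ i t 0) (run p n κ c₀ i t r) →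
    ∃ (_ : CharP κ p) (_ : PerfectField κ) (c₀' : (Fin n → ℕ) → κ) (i' : ℕ → Fin n) (t' : ℕ → Fin n → κ),
      ∀ m, Isol p n κ (run p n κ c₀' i' t' m) ∧ MultP p n κ (run p n κ c₀' i' t' m) := by
  intro hT p hp n hn κ _ _ _ c₀ i t r hr hchain hiso
  haveI : Fact p.Prime := ⟨hp⟩
  haveI hc : CharP κ p := charP_of_injective_algebraMap (algebraMap (ZMod p) κ).injective p
  haveI hP : PerfectField κ := Algebra.IsAlgebraic.perfectField (ZMod p)
  obtain ⟨i', t', h⟩ := NoPeriodicUnwind.unwind_eternal hT hp hn c₀ i t r hr hchain hiso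
  exact ⟨hc, hP, c₀, i', t', h⟩

end Summit.ResolutionOfSingularities.ResolutionOfSingularities.Theorems.FrobeniusClosing

end
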